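import Summits.NavierStokesRegularity.NavierStokesRegularity.Theses.AxisymmetricExtremality
import Summits.NavierStokesRegularity.NavierStokesRegularity.Theorems.AxisymmetricExtremalityAxisymmetricKatoGlobalStubSeregin2020TypeIILemma22ExpansionChain
import HarnessLib

/-!
# Seregin 2020, Lemma 2.2 (after Nazarov–Uraltseva 2012), piece L22-C: «expansion of
# positivity» (N–U Cor 3.3) REDUCED to the three analytic atoms L3.1′, L3.2′, L3.3′

Helper toward the stub `stub_seregin2020TypeII` of the crux `AxisymmetricKatoGlobal` (= the named
fact `Literature.Analysis.FluidPDE.Seregin2020_axisymmetricSingularPoint_typeII`, Seregin 2020,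
Thm 2.1), which the tree reduces to Lemma 2.2 = N–U Lemma 4.2 in class 𝒱 (`hWH′`, hypothesis of
`blowupIndex_eq_top_of_weakHarnack'`). Piece L22-C of Lemma 2.2 (cell pub/ns-inputs; skeleton
`Cruxes/AxisymmetricKatoGlobal/Seregin2020Lemma22ExpansionOfPositivity.lean`) is N–U's Cor 3.3.
`expansionOfPositivity_of_atoms` proves its target statement (the shape consumed by the final
`hWH′` assembly after the measure estimate (4.6)) from the three analytic atoms taken as
hypotheses in the form of their closed statements — L3.1′ (Moser local maximum estimate + Cor
3.1 (2) + Remark 6), L3.2′ (propagation of density), L3.3′ (De Giorgi shrinking) —, each a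
De Giorgi-class statement (joint measurability, continuity off the closed axis set `S`,
nonnegativity, a.e.-`t` `C¹` slices, drift bound `∫_{-R²}^0 (∫_{B(2R)} |U|³)^{4/3} ≤ N R²`, and
the energy inequality across the axis = the L22-B target; all written out, no `def`).
Proof = N–U, end of the proof of Lemma 4.2 and Cor 3.3 (= Cor 3.2 (1) + Lemma 3.4): slice
selection (`exists_mem_Ioo_lt_volume_slice`), L3.2′ on the window `θ₁ = min{½, θ₀(δ₀)}`, L3.3′ on
`B(3R/2)` (`λ = 4/3`), L3.1′ (i) (`λ = 3/2`), the slice `t' = t⁰ - θ₁R²/4`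
(`ae_ball_le_of_ae_cylinder_le`), the chain `chain_lowerBound` with `M = ⌈4/θ₀(1)⌉ + 1` steps,
and `Q(R/2) ⊆ ]t', 0[ × B(R/2)`; all constants depend on `δ`, `N` only.

## References

* A. I. Nazarov, N. N. Uraltseva, St. Petersburg Math. J. 23 (2012) 93–115 = arXiv:1011.1888,
  §3 Cor 3.3 (Lemmas 3.1–3.4, Cor 3.1–3.2, Remarks 6, 9), §4 proof of Lemma 4.2. [NazarovUraltseva2012]
* G. Seregin, Anal. Math. Phys. 10 (2020), Paper 46 = arXiv:2006.04140, Lemma 2.2. [Seregin2020]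
-/

-- the problem directory repeats the summit name (D-0017); core's `dupNamespace` linter fires
set_option linter.dupNamespace false

noncomputable section

open MeasureTheory Set Function Filter Topology TopologicalSpace Metric
open scoped NNReal ENNReal

namespace Summit.NavierStokesRegularity.NavierStokesRegularity.Theorems.AxisymmetricKatoGlobal.EulerScaling

open Literature.Analysis.FluidPDE Literature.Analysis.FluidPDE.Seregin2020

/-! ### Cor 3.3′ = L22-C «expansion of positivity» from the three atoms -/

/-- Volume of a ball of radius `c·R` against the ball of radius `R` in `ℝ³`. [folklore] -/
theorem volume_ball_mul_eq (c R : ℝ) (hc : 0 ≤ c) (hR : 0 ≤ R) :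
    volume (ball (0 : EuclideanSpace ℝ (Fin 3)) (c * R)) =
      ENNReal.ofReal (c ^ 3) * volume (ball (0 : EuclideanSpace ℝ (Fin 3)) R) := by
  have h3 : Module.finrank ℝ (EuclideanSpace ℝ (Fin 3)) = 3 := by simp
  rw [Measure.addHaar_ball volume 0 (mul_nonneg hc hR), Measure.addHaar_ball volume 0 hR, h3,
    ← mul_assoc, ← ENNReal.ofReal_mul (by positivity), mul_pow]

/-- **N–U Cor 3.3 «expansion of positivity» in the De Giorgi-class formulation (= the L22-C
target `stub_expansionOfPositivity` of the skeleton), from the three analytic atoms L3.1′, L3.2′,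
L3.3′ taken as hypotheses (closed statements, written out).** For `δ > 0` and a drift constant
`N` there is `β₃ > 0` such that under the standing hypotheses at scale `R`, axis level `k`, for
every level `0 < κ ≤ k`: if `|{Φ > κ} ∩ ([-R², -¾R²] × B(R))| ≥ δ R⁵` then `Φ ≥ β₃ κ` a.e. on
`Q(R/2)`. Proof (N–U, proof of Lemma 4.2 after (4.6), Cor 3.3 = Cor 3.2 (1) + Lemma 3.4): a
slice `t̄ ∈ ]-R², -¾R²[` with `|{Φ(t̄,·) > κ} ∩ B(R)| > δ₀|B(R)|` (`exists_mem_Ioo_lt_volume_slice`);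
L3.2′ on the window `θ₁ = min{½, θ₀(δ₀)}`; L3.3′ on `B(3R/2) ⊂ B(2R)` (`λ = 4/3`); L3.1′ (i)
with `λ = 3/2` gives `Φ ≥ β₁κ` a.e. on `]t⁰ - θ₁R²/2, t⁰[ × B(R)`, `t⁰ = t̄ + θ₁R² ≤ -R²/4`;
the bound at the slice `t' = t⁰ - θ₁R²/4` (`ae_ball_le_of_ae_cylinder_le`) feeds the chain
`chain_lowerBound` with `M = ⌈4/θ₀(1)⌉ + 1` cylinders down to `B(R/2)` up to time `0`, and
`Q(R/2) ⊆ ]t', 0[ × B(R/2)`. [cite: NazarovUraltseva2012, Cor 3.3, Cor 3.2 (1), Lemma 3.4 and the end of the proof of Lemma 4.2] -/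
theorem expansionOfPositivity_of_atoms
    (hL31 : ∀ (lamlo θlo θhi : ℝ) (N : ℝ≥0), 1 < lamlo → lamlo ≤ 2 → 0 < θlo → θlo ≤ θhi →
      ∃ μ₁ : ℝ, 0 < μ₁ ∧
      ∀ (Φ : ℝ → EuclideanSpace ℝ (Fin 3) → ℝ) (U : ℝ → EuclideanSpace ℝ (Fin 3) → EuclideanSpace ℝ (Fin 3))
        (S : Set (ℝ × EuclideanSpace ℝ (Fin 3))) (k R : ℝ), (0 < k ∧ 0 < R ∧ Measurable (uncurry Φ) ∧ AEStronglyMeasurable (uncurry U) volume ∧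
          IsClosed S ∧ (∀ z ∈ S, cylRadius z.2 = 0) ∧ ContinuousOn (uncurry Φ) ({z : ℝ ×
          EuclideanSpace ℝ (Fin 3) | z.1 < 0} \ S) ∧ (∀ t x, 0 ≤ Φ t x) ∧ (∀ᵐ t : ℝ, t ∈ Ioo (-R ^
          2) 0 → ContDiff ℝ 1 (Φ t)) ∧ (∫⁻ s in Ioo (-R ^ 2) 0, (∫⁻ y in ball (0 : EuclideanSpace ℝ
          (Fin 3)) (2 * R), ‖U s y‖ₑ ^ (3 : ℕ)) ^ (4 / 3 : ℝ) ≤ (N : ℝ≥0∞) * ENNReal.ofReal R ^ 2) ∧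
          (∀ (H : ℝ → ℝ), ContDiff ℝ 2 H → (∀ v, deriv H v ≤ 0) → (∀ v, 0 ≤ H v) → (∀ v, 0 ≤ deriv
          (deriv H) v) → (∀ v, deriv H v ^ 2 ≤ 2 * H v * deriv (deriv H) v) → (∀ v, k ≤ v → H v = 0)
          → ∀ (Θ : EuclideanSpace ℝ (Fin 3) → ℝ), ContDiff ℝ 1 Θ → HasCompactSupport Θ → tsupport Θ
          ⊆ ball (0 : EuclideanSpace ℝ (Fin 3)) (2 * R) → ∀ (η : ℝ → ℝ), ContDiff ℝ 1 η → (∀ s, 0 ≤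
          η s) → ∀ (t₁ t₂ : ℝ), -R ^ 2 < t₁ → t₁ ≤ t₂ → t₂ < 0 → ENNReal.ofReal (η t₂ * ∫ x, H (Φ t₂
          x) * Θ x ^ 2) + ∫⁻ z in Icc t₁ t₂ ×ˢ (univ : Set (EuclideanSpace ℝ (Fin 3))),
          ENNReal.ofReal (1 / 2 * η z.1 * (deriv (deriv H) (Φ z.1 z.2) * ‖gradient (Φ z.1) z.2‖ ^ 2
          * Θ z.2 ^ 2)) ≤ ENNReal.ofReal (η t₁ * ∫ x, H (Φ t₁ x) * Θ x ^ 2 + (4 * ∫ z in Icc t₁ t₂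
          ×ˢ (univ : Set (EuclideanSpace ℝ (Fin 3))), η z.1 * (H (Φ z.1 z.2) * ‖gradient Θ z.2‖ ^
          2)) + (∫ z in Icc t₁ t₂ ×ˢ (univ : Set (EuclideanSpace ℝ (Fin 3))), η z.1 * (H (Φ z.1 z.2)
          * inner ℝ (U z.1 z.2) (gradient (fun y => Θ y ^ 2) z.2))) + (∫ z in Icc t₁ t₂ ×ˢ (univ :
          Set (EuclideanSpace ℝ (Fin 3))), η z.1 * (2 / cylRadius z.2 * (H (Φ z.1 z.2) * fderiv ℝ
          (fun y => Θ y ^ 2) z.2 (eR z.2)))) + ∫ z in Icc t₁ t₂ ×ˢ (univ : Set (EuclideanSpace ℝ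
          (Fin 3))), |deriv η z.1| * (H (Φ z.1 z.2) * Θ z.2 ^ 2)))) →
      ∀ (lam ρ θ t₀ l : ℝ), lamlo ≤ lam → lam ≤ 2 → R / 4 ≤ ρ → lam * ρ ≤ 2 * R → θlo ≤ θ → θ ≤ θhi →
        t₀ ≤ 0 → -R ^ 2 < t₀ - θ * ρ ^ 2 → 0 < l → l ≤ k →
        volume {z : ℝ × EuclideanSpace ℝ (Fin 3) |
            z ∈ Ioo (t₀ - θ * ρ ^ 2) t₀ ×ˢ ball (0 : EuclideanSpace ℝ (Fin 3)) (lam * ρ) ∧ Φ z.1 z.2 < l}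
          ≤ ENNReal.ofReal μ₁ * volume (Ioo (t₀ - θ * ρ ^ 2) t₀ ×ˢ ball (0 : EuclideanSpace ℝ (Fin 3)) (lam * ρ)) →
        (∀ᵐ z ∂(volume.restrict (Ioo (t₀ - θ / 2 * ρ ^ 2) t₀ ×ˢ ball (0 : EuclideanSpace ℝ (Fin 3)) ρ)),
            l / 2 ≤ Φ z.1 z.2) ∧
        ((∀ᵐ x ∂(volume.restrict (ball (0 : EuclideanSpace ℝ (Fin 3)) (lam * ρ))), l ≤ Φ (t₀ - θ * ρ ^ 2) x) →
          ∀ᵐ z ∂(volume.restrict (Ioo (t₀ - θ * ρ ^ 2) t₀ ×ˢ ball (0 : EuclideanSpace ℝ (Fin 3)) ρ)),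
            l / 2 ≤ Φ z.1 z.2))
    (hL32 : ∀ (δ₀ : ℝ) (N : ℝ≥0), 0 < δ₀ → δ₀ ≤ 1 →
      ∃ θ₀ : ℝ, 0 < θ₀ ∧ θ₀ < 1 ∧
      ∀ (Φ : ℝ → EuclideanSpace ℝ (Fin 3) → ℝ) (U : ℝ → EuclideanSpace ℝ (Fin 3) → EuclideanSpace ℝ (Fin 3))
        (S : Set (ℝ × EuclideanSpace ℝ (Fin 3))) (k R : ℝ), (0 < k ∧ 0 < R ∧ Measurable (uncurry Φ) ∧ AEStronglyMeasurable (uncurry U) volume ∧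
          IsClosed S ∧ (∀ z ∈ S, cylRadius z.2 = 0) ∧ ContinuousOn (uncurry Φ) ({z : ℝ ×
          EuclideanSpace ℝ (Fin 3) | z.1 < 0} \ S) ∧ (∀ t x, 0 ≤ Φ t x) ∧ (∀ᵐ t : ℝ, t ∈ Ioo (-R ^
          2) 0 → ContDiff ℝ 1 (Φ t)) ∧ (∫⁻ s in Ioo (-R ^ 2) 0, (∫⁻ y in ball (0 : EuclideanSpace ℝ
          (Fin 3)) (2 * R), ‖U s y‖ₑ ^ (3 : ℕ)) ^ (4 / 3 : ℝ) ≤ (N : ℝ≥0∞) * ENNReal.ofReal R ^ 2) ∧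
          (∀ (H : ℝ → ℝ), ContDiff ℝ 2 H → (∀ v, deriv H v ≤ 0) → (∀ v, 0 ≤ H v) → (∀ v, 0 ≤ deriv
          (deriv H) v) → (∀ v, deriv H v ^ 2 ≤ 2 * H v * deriv (deriv H) v) → (∀ v, k ≤ v → H v = 0)
          → ∀ (Θ : EuclideanSpace ℝ (Fin 3) → ℝ), ContDiff ℝ 1 Θ → HasCompactSupport Θ → tsupport Θ
          ⊆ ball (0 : EuclideanSpace ℝ (Fin 3)) (2 * R) → ∀ (η : ℝ → ℝ), ContDiff ℝ 1 η → (∀ s, 0 ≤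
          η s) → ∀ (t₁ t₂ : ℝ), -R ^ 2 < t₁ → t₁ ≤ t₂ → t₂ < 0 → ENNReal.ofReal (η t₂ * ∫ x, H (Φ t₂
          x) * Θ x ^ 2) + ∫⁻ z in Icc t₁ t₂ ×ˢ (univ : Set (EuclideanSpace ℝ (Fin 3))),
          ENNReal.ofReal (1 / 2 * η z.1 * (deriv (deriv H) (Φ z.1 z.2) * ‖gradient (Φ z.1) z.2‖ ^ 2
          * Θ z.2 ^ 2)) ≤ ENNReal.ofReal (η t₁ * ∫ x, H (Φ t₁ x) * Θ x ^ 2 + (4 * ∫ z in Icc t₁ t₂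
          ×ˢ (univ : Set (EuclideanSpace ℝ (Fin 3))), η z.1 * (H (Φ z.1 z.2) * ‖gradient Θ z.2‖ ^
          2)) + (∫ z in Icc t₁ t₂ ×ˢ (univ : Set (EuclideanSpace ℝ (Fin 3))), η z.1 * (H (Φ z.1 z.2)
          * inner ℝ (U z.1 z.2) (gradient (fun y => Θ y ^ 2) z.2))) + (∫ z in Icc t₁ t₂ ×ˢ (univ :
          Set (EuclideanSpace ℝ (Fin 3))), η z.1 * (2 / cylRadius z.2 * (H (Φ z.1 z.2) * fderiv ℝ
          (fun y => Θ y ^ 2) z.2 (eR z.2)))) + ∫ z in Icc t₁ t₂ ×ˢ (univ : Set (EuclideanSpace ℝ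
          (Fin 3))), |deriv η z.1| * (H (Φ z.1 z.2) * Θ z.2 ^ 2)))) →
      ∀ (ρ θ t₀ κ : ℝ), R / 4 ≤ ρ → ρ ≤ 2 * R → 0 < θ → θ ≤ θ₀ →
        t₀ ≤ 0 → -R ^ 2 < t₀ - θ * ρ ^ 2 → 0 < κ → κ ≤ k →
        ENNReal.ofReal δ₀ * volume (ball (0 : EuclideanSpace ℝ (Fin 3)) ρ)
          ≤ volume {x : EuclideanSpace ℝ (Fin 3) | x ∈ ball (0 : EuclideanSpace ℝ (Fin 3)) ρ ∧ κ ≤ Φ (t₀ - θ * ρ ^ 2) x} →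
        ∀ t ∈ Icc (t₀ - θ * ρ ^ 2) t₀, t < 0 →
          ENNReal.ofReal (δ₀ / 3) * volume (ball (0 : EuclideanSpace ℝ (Fin 3)) ρ)
            ≤ volume {x : EuclideanSpace ℝ (Fin 3) | x ∈ ball (0 : EuclideanSpace ℝ (Fin 3)) ρ ∧ δ₀ * κ / 3 ≤ Φ t x})
    (hL33 : ∀ (lamlo θlo θhi μ δ₁ : ℝ) (N : ℝ≥0), 1 < lamlo → lamlo ≤ 2 → 0 < θlo → θlo ≤ θhi →
      0 < μ → μ < 1 → 0 < δ₁ →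
      ∃ s : ℕ,
      ∀ (Φ : ℝ → EuclideanSpace ℝ (Fin 3) → ℝ) (U : ℝ → EuclideanSpace ℝ (Fin 3) → EuclideanSpace ℝ (Fin 3))
        (S : Set (ℝ × EuclideanSpace ℝ (Fin 3))) (k R : ℝ), (0 < k ∧ 0 < R ∧ Measurable (uncurry Φ) ∧ AEStronglyMeasurable (uncurry U) volume ∧
          IsClosed S ∧ (∀ z ∈ S, cylRadius z.2 = 0) ∧ ContinuousOn (uncurry Φ) ({z : ℝ ×
          EuclideanSpace ℝ (Fin 3) | z.1 < 0} \ S) ∧ (∀ t x, 0 ≤ Φ t x) ∧ (∀ᵐ t : ℝ, t ∈ Ioo (-R ^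
          2) 0 → ContDiff ℝ 1 (Φ t)) ∧ (∫⁻ s in Ioo (-R ^ 2) 0, (∫⁻ y in ball (0 : EuclideanSpace ℝ
          (Fin 3)) (2 * R), ‖U s y‖ₑ ^ (3 : ℕ)) ^ (4 / 3 : ℝ) ≤ (N : ℝ≥0∞) * ENNReal.ofReal R ^ 2) ∧
          (∀ (H : ℝ → ℝ), ContDiff ℝ 2 H → (∀ v, deriv H v ≤ 0) → (∀ v, 0 ≤ H v) → (∀ v, 0 ≤ deriv
          (deriv H) v) → (∀ v, deriv H v ^ 2 ≤ 2 * H v * deriv (deriv H) v) → (∀ v, k ≤ v → H v = 0)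
          → ∀ (Θ : EuclideanSpace ℝ (Fin 3) → ℝ), ContDiff ℝ 1 Θ → HasCompactSupport Θ → tsupport Θ
          ⊆ ball (0 : EuclideanSpace ℝ (Fin 3)) (2 * R) → ∀ (η : ℝ → ℝ), ContDiff ℝ 1 η → (∀ s, 0 ≤
          η s) → ∀ (t₁ t₂ : ℝ), -R ^ 2 < t₁ → t₁ ≤ t₂ → t₂ < 0 → ENNReal.ofReal (η t₂ * ∫ x, H (Φ t₂
          x) * Θ x ^ 2) + ∫⁻ z in Icc t₁ t₂ ×ˢ (univ : Set (EuclideanSpace ℝ (Fin 3))),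
          ENNReal.ofReal (1 / 2 * η z.1 * (deriv (deriv H) (Φ z.1 z.2) * ‖gradient (Φ z.1) z.2‖ ^ 2
          * Θ z.2 ^ 2)) ≤ ENNReal.ofReal (η t₁ * ∫ x, H (Φ t₁ x) * Θ x ^ 2 + (4 * ∫ z in Icc t₁ t₂
          ×ˢ (univ : Set (EuclideanSpace ℝ (Fin 3))), η z.1 * (H (Φ z.1 z.2) * ‖gradient Θ z.2‖ ^
          2)) + (∫ z in Icc t₁ t₂ ×ˢ (univ : Set (EuclideanSpace ℝ (Fin 3))), η z.1 * (H (Φ z.1 z.2)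
          * inner ℝ (U z.1 z.2) (gradient (fun y => Θ y ^ 2) z.2))) + (∫ z in Icc t₁ t₂ ×ˢ (univ :
          Set (EuclideanSpace ℝ (Fin 3))), η z.1 * (2 / cylRadius z.2 * (H (Φ z.1 z.2) * fderiv ℝ
          (fun y => Θ y ^ 2) z.2 (eR z.2)))) + ∫ z in Icc t₁ t₂ ×ˢ (univ : Set (EuclideanSpace ℝ
          (Fin 3))), |deriv η z.1| * (H (Φ z.1 z.2) * Θ z.2 ^ 2)))) →
      ∀ (lam ρ θ t₀ κ₀ : ℝ), lamlo ≤ lam → lam ≤ 2 → R / 4 ≤ ρ → lam * ρ ≤ 2 * R → θlo ≤ θ → θ ≤ θhi →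
        t₀ ≤ 0 → -R ^ 2 < t₀ - θ * ρ ^ 2 → 0 < κ₀ → κ₀ ≤ k →
        (∀ᵐ t ∂(volume.restrict (Ioo (t₀ - θ * ρ ^ 2) t₀)),
          ENNReal.ofReal δ₁ * volume (ball (0 : EuclideanSpace ℝ (Fin 3)) ρ)
            ≤ volume {x : EuclideanSpace ℝ (Fin 3) | x ∈ ball (0 : EuclideanSpace ℝ (Fin 3)) ρ ∧ κ₀ ≤ Φ t x}) →
        volume {z : ℝ × EuclideanSpace ℝ (Fin 3) |
            z ∈ Ioo (t₀ - θ * ρ ^ 2) t₀ ×ˢ ball (0 : EuclideanSpace ℝ (Fin 3)) ρ ∧ Φ z.1 z.2 < (2 : ℝ)⁻¹ ^ s * κ₀}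
          ≤ ENNReal.ofReal μ * volume (Ioo (t₀ - θ * ρ ^ 2) t₀ ×ˢ ball (0 : EuclideanSpace ℝ (Fin 3)) ρ)) :
    ∀ (δ : ℝ) (N : ℝ≥0), 0 < δ →
    ∃ β₃ : ℝ, 0 < β₃ ∧
    ∀ (Φ : ℝ → EuclideanSpace ℝ (Fin 3) → ℝ) (U : ℝ → EuclideanSpace ℝ (Fin 3) → EuclideanSpace ℝ (Fin 3))
      (S : Set (ℝ × EuclideanSpace ℝ (Fin 3))) (k R : ℝ), (0 < k ∧ 0 < R ∧ Measurable (uncurry Φ) ∧ AEStronglyMeasurable (uncurry U) volume ∧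
          IsClosed S ∧ (∀ z ∈ S, cylRadius z.2 = 0) ∧ ContinuousOn (uncurry Φ) ({z : ℝ ×
          EuclideanSpace ℝ (Fin 3) | z.1 < 0} \ S) ∧ (∀ t x, 0 ≤ Φ t x) ∧ (∀ᵐ t : ℝ, t ∈ Ioo (-R ^
          2) 0 → ContDiff ℝ 1 (Φ t)) ∧ (∫⁻ s in Ioo (-R ^ 2) 0, (∫⁻ y in ball (0 : EuclideanSpace ℝ
          (Fin 3)) (2 * R), ‖U s y‖ₑ ^ (3 : ℕ)) ^ (4 / 3 : ℝ) ≤ (N : ℝ≥0∞) * ENNReal.ofReal R ^ 2) ∧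
          (∀ (H : ℝ → ℝ), ContDiff ℝ 2 H → (∀ v, deriv H v ≤ 0) → (∀ v, 0 ≤ H v) → (∀ v, 0 ≤ deriv
          (deriv H) v) → (∀ v, deriv H v ^ 2 ≤ 2 * H v * deriv (deriv H) v) → (∀ v, k ≤ v → H v = 0)
          → ∀ (Θ : EuclideanSpace ℝ (Fin 3) → ℝ), ContDiff ℝ 1 Θ → HasCompactSupport Θ → tsupport Θ
          ⊆ ball (0 : EuclideanSpace ℝ (Fin 3)) (2 * R) → ∀ (η : ℝ → ℝ), ContDiff ℝ 1 η → (∀ s, 0 ≤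
          η s) → ∀ (t₁ t₂ : ℝ), -R ^ 2 < t₁ → t₁ ≤ t₂ → t₂ < 0 → ENNReal.ofReal (η t₂ * ∫ x, H (Φ t₂
          x) * Θ x ^ 2) + ∫⁻ z in Icc t₁ t₂ ×ˢ (univ : Set (EuclideanSpace ℝ (Fin 3))),
          ENNReal.ofReal (1 / 2 * η z.1 * (deriv (deriv H) (Φ z.1 z.2) * ‖gradient (Φ z.1) z.2‖ ^ 2
          * Θ z.2 ^ 2)) ≤ ENNReal.ofReal (η t₁ * ∫ x, H (Φ t₁ x) * Θ x ^ 2 + (4 * ∫ z in Icc t₁ t₂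
          ×ˢ (univ : Set (EuclideanSpace ℝ (Fin 3))), η z.1 * (H (Φ z.1 z.2) * ‖gradient Θ z.2‖ ^
          2)) + (∫ z in Icc t₁ t₂ ×ˢ (univ : Set (EuclideanSpace ℝ (Fin 3))), η z.1 * (H (Φ z.1 z.2)
          * inner ℝ (U z.1 z.2) (gradient (fun y => Θ y ^ 2) z.2))) + (∫ z in Icc t₁ t₂ ×ˢ (univ :
          Set (EuclideanSpace ℝ (Fin 3))), η z.1 * (2 / cylRadius z.2 * (H (Φ z.1 z.2) * fderiv ℝ
          (fun y => Θ y ^ 2) z.2 (eR z.2)))) + ∫ z in Icc t₁ t₂ ×ˢ (univ : Set (EuclideanSpace ℝ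
          (Fin 3))), |deriv η z.1| * (H (Φ z.1 z.2) * Θ z.2 ^ 2)))) →
    ∀ (κ : ℝ), 0 < κ → κ ≤ k →
      ENNReal.ofReal (δ * R ^ 5)
        ≤ volume {z : ℝ × EuclideanSpace ℝ (Fin 3) |
            z ∈ Icc (-R ^ 2) (-(3 / 4) * R ^ 2) ×ˢ ball (0 : EuclideanSpace ℝ (Fin 3)) R ∧ κ < Φ z.1 z.2} →
      ∀ᵐ z ∂(volume.restrict (parabolicCylinder (R / 2) (0 : ℝ × EuclideanSpace ℝ (Fin 3)))),
        β₃ * κ ≤ Φ z.1 z.2 := by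
  intro δ N hδ
  -- ### constants (depending on `δ`, `N` only)
  have hV0 : 0 < volume (ball (0 : EuclideanSpace ℝ (Fin 3)) 1) := measure_ball_pos volume 0 one_pos
  have hVtop : volume (ball (0 : EuclideanSpace ℝ (Fin 3)) 1) < ∞ := measure_ball_lt_top
  obtain ⟨v, hv⟩ : ∃ v : ℝ, v = (volume (ball (0 : EuclideanSpace ℝ (Fin 3)) 1)).toReal := ⟨_, rfl⟩
  have hvpos : 0 < v := by rw [hv]; exact ENNReal.toReal_pos hV0.ne' hVtop.ne
  have hVeq : volume (ball (0 : EuclideanSpace ℝ (Fin 3)) 1) = ENNReal.ofReal v := by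
    rw [hv, ENNReal.ofReal_toReal hVtop.ne]
  -- density `δ₀` at the selected slice
  obtain ⟨δ₀, hδ₀⟩ : ∃ x : ℝ, x = min 1 (2 * δ / v) := ⟨_, rfl⟩
  have hδ₀pos : 0 < δ₀ := by rw [hδ₀]; exact lt_min one_pos (by positivity)
  have hδ₀le : δ₀ ≤ 1 := by rw [hδ₀]; exact min_le_left _ _
  have hδ₀v : δ₀ * v ≤ 2 * δ := by
    have : δ₀ ≤ 2 * δ / v := by rw [hδ₀]; exact min_le_right _ _
    rwa [le_div_iff₀ hvpos] at this
  -- Step 1 constants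
  obtain ⟨θ₀, hθ₀pos, -, h32⟩ := hL32 δ₀ N hδ₀pos hδ₀le
  obtain ⟨θ₁, hθ₁⟩ : ∃ x : ℝ, x = min (1 / 2) θ₀ := ⟨_, rfl⟩
  have hθ₁pos : 0 < θ₁ := by rw [hθ₁]; exact lt_min (by norm_num) hθ₀pos
  have hθ₁le : θ₁ ≤ θ₀ := by rw [hθ₁]; exact min_le_right _ _
  have hθ₁half : θ₁ ≤ 1 / 2 := by rw [hθ₁]; exact min_le_left _ _
  obtain ⟨μ₁, hμ₁pos, h31⟩ := hL31 (3 / 2) θ₁ θ₁ N (by norm_num) (by norm_num) hθ₁pos le_rfl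
  obtain ⟨μ, hμ⟩ : ∃ x : ℝ, x = min μ₁ (1 / 2) := ⟨_, rfl⟩
  have hμpos : 0 < μ := by rw [hμ]; exact lt_min hμ₁pos (by norm_num)
  have hμlt : μ < 1 := by rw [hμ]; exact lt_of_le_of_lt (min_le_right _ _) (by norm_num)
  have hμle : μ ≤ μ₁ := by rw [hμ]; exact min_le_left _ _
  obtain ⟨s, h33⟩ := hL33 (4 / 3) (4 * θ₁ / 9) (4 * θ₁ / 9) μ (8 * δ₀ / 81) N (by norm_num)
    (by norm_num) (by positivity) le_rfl hμpos hμlt (by positivity)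
  -- chain constants
  obtain ⟨θ₀₁, hθ₀₁pos, -, h32'⟩ := hL32 1 N one_pos le_rfl
  obtain ⟨M, hMdef⟩ : ∃ M : ℕ, M = ⌈4 / θ₀₁⌉₊ + 1 := ⟨_, rfl⟩
  have hM1 : 1 ≤ M := by rw [hMdef]; exact Nat.le_add_left 1 _
  have hMr : (1 : ℝ) ≤ M := by exact_mod_cast hM1
  have hMpos : (0 : ℝ) < M := by linarith only [hMr]
  have hMθ : 4 / (M : ℝ) ≤ θ₀₁ := by
    rw [div_le_iff₀ hMpos]
    have h1 : 4 / θ₀₁ ≤ ⌈4 / θ₀₁⌉₊ := Nat.le_ceil _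
    have h2 : (M : ℝ) = ⌈4 / θ₀₁⌉₊ + 1 := by rw [hMdef]; push_cast; ring
    rw [div_le_iff₀ hθ₀₁pos] at h1
    rw [h2]
    nlinarith only [h1, hθ₀₁pos]
  obtain ⟨lamlo', hlamlo'⟩ : ∃ x : ℝ, x = 1 + 1 / (2 * M) := ⟨_, rfl⟩
  obtain ⟨θlo', hθlo'⟩ : ∃ x : ℝ, x = 1 / (4 * M) := ⟨_, rfl⟩
  obtain ⟨θhi', hθhi'⟩ : ∃ x : ℝ, x = 16 / M := ⟨_, rfl⟩
  have hM2 : 0 < 1 / (2 * (M : ℝ)) := by positivity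
  have hM2' : 1 / (2 * (M : ℝ)) ≤ 1 := by
    rw [div_le_one (by positivity)]; linarith only [hMr]
  have hlamlo'1 : 1 < lamlo' := by rw [hlamlo']; linarith only [hM2]
  have hlamlo'2 : lamlo' ≤ 2 := by rw [hlamlo']; linarith only [hM2']
  have hθlo'pos : 0 < θlo' := by rw [hθlo']; positivity
  have hθlohi' : θlo' ≤ θhi' := by
    rw [hθlo', hθhi', div_le_div_iff₀ (by positivity) hMpos]; nlinarith only [hMr]
  obtain ⟨μ₁', hμ₁'pos, h31'⟩ := hL31 lamlo' θlo' θhi' N hlamlo'1 hlamlo'2 hθlo'pos hθlohi'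
  obtain ⟨μ', hμ'⟩ : ∃ x : ℝ, x = min μ₁' (1 / 2) := ⟨_, rfl⟩
  have hμ'pos : 0 < μ' := by rw [hμ']; exact lt_min hμ₁'pos (by norm_num)
  have hμ'lt : μ' < 1 := by rw [hμ']; exact lt_of_le_of_lt (min_le_right _ _) (by norm_num)
  have hμ'le : μ' ≤ μ₁' := by rw [hμ']; exact min_le_left _ _
  obtain ⟨s', h33'⟩ := hL33 2 θlo' θhi' μ' (1 / 3) N (by norm_num) le_rfl hθlo'pos hθlohi'
    hμ'pos hμ'lt (by norm_num)
  -- the constant `β₃ = β₂ β₁`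
  refine ⟨((2 : ℝ)⁻¹ ^ (s' + 1) / 3) ^ M * ((2 : ℝ)⁻¹ ^ (s + 1) * δ₀ / 3), by positivity, ?_⟩
  -- ### the data
  intro Φ U S k R hSt κ hκ hκk hvol
  have hSt' := hSt
  obtain ⟨hk, hR, hΦm, -, hS, hSax, hcont, -, -, -, -⟩ := hSt'
  have hR2 : 0 < R ^ 2 := by positivity
  -- ### selection of `t̄`
  have hAm : MeasurableSet {z : ℝ × EuclideanSpace ℝ (Fin 3) |
      z ∈ Icc (-R ^ 2) (-(3 / 4) * R ^ 2) ×ˢ ball (0 : EuclideanSpace ℝ (Fin 3)) R ∧ κ < Φ z.1 z.2} :=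
    (measurableSet_Icc.prod measurableSet_ball).inter (measurableSet_lt measurable_const hΦm)
  have hAsub : {z : ℝ × EuclideanSpace ℝ (Fin 3) |
      z ∈ Icc (-R ^ 2) (-(3 / 4) * R ^ 2) ×ˢ ball (0 : EuclideanSpace ℝ (Fin 3)) R ∧ κ < Φ z.1 z.2} ⊆
      Icc (-R ^ 2) (-(3 / 4) * R ^ 2) ×ˢ (univ : Set (EuclideanSpace ℝ (Fin 3))) :=
    fun z hz => ⟨hz.1.1, mem_univ _⟩
  have hballR : volume (ball (0 : EuclideanSpace ℝ (Fin 3)) R) = ENNReal.ofReal (R ^ 3 * v) := by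
    have e := volume_ball_mul_eq R 1 hR.le zero_le_one
    rw [mul_one] at e
    rw [e, hVeq, ← ENNReal.ofReal_mul (by positivity)]
  have hC : ENNReal.ofReal δ₀ * volume (ball (0 : EuclideanSpace ℝ (Fin 3)) R) *
      ENNReal.ofReal (-(3 / 4) * R ^ 2 - -R ^ 2) < volume {z : ℝ × EuclideanSpace ℝ (Fin 3) |
      z ∈ Icc (-R ^ 2) (-(3 / 4) * R ^ 2) ×ˢ ball (0 : EuclideanSpace ℝ (Fin 3)) R ∧ κ < Φ z.1 z.2} := by
    refine lt_of_lt_of_le ?_ hvol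
    rw [hballR, ← ENNReal.ofReal_mul hδ₀pos.le, ← ENNReal.ofReal_mul (by positivity),
      ENNReal.ofReal_lt_ofReal_iff (by positivity)]
    have e : δ₀ * (R ^ 3 * v) * (-(3 / 4) * R ^ 2 - -R ^ 2) = (δ₀ * v) * R ^ 5 / 4 := by ring
    rw [e]
    have hR5 : 0 < R ^ 5 := by positivity
    nlinarith only [hδ₀v, hR5, hδ]
  obtain ⟨tbar, htbar, hslice0⟩ := exists_mem_Ioo_lt_volume_slice hAm hAsub hC
  have hdens : ENNReal.ofReal δ₀ * volume (ball (0 : EuclideanSpace ℝ (Fin 3)) R) ≤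
      volume {x : EuclideanSpace ℝ (Fin 3) |
        x ∈ ball (0 : EuclideanSpace ℝ (Fin 3)) R ∧ κ ≤ Φ tbar x} := by
    refine hslice0.le.trans (measure_mono ?_)
    intro x hx
    exact ⟨hx.1.2, le_of_lt hx.2⟩
  -- ### Step 1 (N–U Cor 3.2 (1)): `Φ ≥ β₁ κ` a.e. on `]t⁰ - θ₁R²/2, t⁰[ × B(R)`
  obtain ⟨t₀, ht₀⟩ : ∃ x : ℝ, x = tbar + θ₁ * R ^ 2 := ⟨_, rfl⟩
  have e0 : t₀ - θ₁ * R ^ 2 = tbar := by rw [ht₀]; ring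
  have ht₀le : t₀ ≤ -R ^ 2 / 4 := by
    rw [ht₀]
    have h1 := htbar.2
    have h2 : θ₁ * R ^ 2 ≤ 1 / 2 * R ^ 2 := mul_le_mul_of_nonneg_right hθ₁half hR2.le
    linarith only [h1, h2]
  have ht₀le0 : t₀ ≤ 0 := ht₀le.trans (by linarith only [hR2])
  -- L3.2′
  have hA2 := h32 Φ U S k R hSt R θ₁ t₀ κ (by linarith only [hR]) (by linarith only [hR])
    hθ₁pos hθ₁le ht₀le0 (by rw [e0]; exact htbar.1) hκ hκk (by rw [e0]; exact hdens)
  rw [e0] at hA2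
  -- L3.3′ on `B(3R/2)` with `λ = 4/3`
  have e33 : t₀ - 4 * θ₁ / 9 * (3 / 2 * R) ^ 2 = tbar := by rw [ht₀]; ring
  have hball32 : volume (ball (0 : EuclideanSpace ℝ (Fin 3)) (3 / 2 * R)) =
      ENNReal.ofReal ((3 / 2) ^ 3) * volume (ball (0 : EuclideanSpace ℝ (Fin 3)) R) :=
    volume_ball_mul_eq (3 / 2) R (by norm_num) hR.le
  have hκ₀k : δ₀ * κ / 3 ≤ k := by
    have : δ₀ * κ ≤ 1 * κ := mul_le_mul_of_nonneg_right hδ₀le hκ.le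
    linarith only [this, hκk, hκ]
  have hdens33 : ∀ᵐ t ∂(volume.restrict (Ioo (t₀ - 4 * θ₁ / 9 * (3 / 2 * R) ^ 2) t₀)),
      ENNReal.ofReal (8 * δ₀ / 81) * volume (ball (0 : EuclideanSpace ℝ (Fin 3)) (3 / 2 * R))
        ≤ volume {x : EuclideanSpace ℝ (Fin 3) |
            x ∈ ball (0 : EuclideanSpace ℝ (Fin 3)) (3 / 2 * R) ∧ δ₀ * κ / 3 ≤ Φ t x} := by
    rw [e33, ae_restrict_iff' measurableSet_Ioo]
    refine ae_of_all _ fun t ht => ?_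
    have h1 := hA2 t ⟨ht.1.le, ht.2.le⟩ (lt_of_lt_of_le ht.2 ht₀le0)
    calc ENNReal.ofReal (8 * δ₀ / 81) * volume (ball (0 : EuclideanSpace ℝ (Fin 3)) (3 / 2 * R))
        = ENNReal.ofReal (δ₀ / 3) * volume (ball (0 : EuclideanSpace ℝ (Fin 3)) R) := by
          rw [hball32, ← mul_assoc, ← ENNReal.ofReal_mul (by positivity)]
          congr 1
          congr 1
          ring
      _ ≤ volume {x : EuclideanSpace ℝ (Fin 3) |
            x ∈ ball (0 : EuclideanSpace ℝ (Fin 3)) R ∧ δ₀ * κ / 3 ≤ Φ t x} := h1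
      _ ≤ volume {x : EuclideanSpace ℝ (Fin 3) |
            x ∈ ball (0 : EuclideanSpace ℝ (Fin 3)) (3 / 2 * R) ∧ δ₀ * κ / 3 ≤ Φ t x} := by
          refine measure_mono fun x hx => ⟨?_, hx.2⟩
          exact ball_subset_ball (by linarith only [hR]) hx.1
  have hA3 := h33 Φ U S k R hSt (4 / 3) (3 / 2 * R) (4 * θ₁ / 9) t₀ (δ₀ * κ / 3) le_rfl
    (by norm_num) (by linarith only [hR]) (by linarith only [hR]) le_rfl le_rfl ht₀le0
    (by rw [e33]; exact htbar.1) (by positivity) hκ₀k hdens33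
  rw [e33] at hA3
  -- L3.1′ (i) with `λ = 3/2`, `ρ = R`
  have hl0 : 0 < (2 : ℝ)⁻¹ ^ s * (δ₀ * κ / 3) := by positivity
  have hl1 : (2 : ℝ)⁻¹ ^ s * (δ₀ * κ / 3) ≤ k := by
    have hp : (2 : ℝ)⁻¹ ^ s ≤ 1 := pow_le_one₀ (by norm_num) (by norm_num)
    have h1 : (2 : ℝ)⁻¹ ^ s * (δ₀ * κ / 3) ≤ 1 * (δ₀ * κ / 3) :=
      mul_le_mul_of_nonneg_right hp (by positivity)
    linarith only [h1, hκ₀k]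
  have hA1 := h31 Φ U S k R hSt (3 / 2) R θ₁ t₀ ((2 : ℝ)⁻¹ ^ s * (δ₀ * κ / 3)) le_rfl
    (by norm_num) (by linarith only [hR]) (by linarith only [hR]) le_rfl le_rfl ht₀le0
    (by rw [e0]; exact htbar.1) hl0 hl1
  rw [e0] at hA1
  have hcyl1 := (hA1 (hA3.trans (by gcongr))).1
  -- ### the slice `t' = t⁰ - θ₁R²/4` and the chain
  obtain ⟨t', ht'⟩ : ∃ x : ℝ, x = t₀ - θ₁ / 4 * R ^ 2 := ⟨_, rfl⟩
  have hθR : 0 < θ₁ * R ^ 2 := mul_pos hθ₁pos hR2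
  have ht'lt : t' < t₀ := by rw [ht']; linarith only [hθR]
  have ht'gt : t₀ - θ₁ / 2 * R ^ 2 < t' := by rw [ht']; linarith only [hθR]
  have ht'le : t' ≤ -R ^ 2 / 4 := ht'lt.le.trans ht₀le
  have ht'neg : t' < 0 := lt_of_le_of_lt ht'le (by linarith only [hR2])
  have ht'gtR : -R ^ 2 < t' := by
    have h1 : tbar ≤ t₀ - θ₁ / 2 * R ^ 2 := by rw [ht₀]; linarith only [hθR]
    linarith only [htbar.1, h1, ht'gt]
  have hsl := ae_ball_le_of_ae_cylinder_le hS hSax hcont ht₀le0 hcyl1 t' ⟨ht'gt, ht'lt.le⟩ ht'neg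
  -- the step `h = -t'/M`
  obtain ⟨h, hh⟩ : ∃ x : ℝ, x = -t' / M := ⟨_, rfl⟩
  have hhpos : 0 < h := by rw [hh]; exact div_pos (by linarith only [ht'neg]) hMpos
  have hMh : (M : ℝ) * h = -t' := by rw [hh]; field_simp
  have hMh' : (M : ℝ) * h < R ^ 2 := by rw [hMh]; linarith only [ht'gtR]
  have ht'eq : -((M : ℝ) * h) = t' := by rw [hMh]; ring
  have hhR1 : θlo' ≤ h / R ^ 2 := by
    rw [hθlo', div_le_div_iff₀ (by positivity) hR2]
    calc 1 * R ^ 2 ≤ 4 * -t' := by linarith only [ht'le]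
      _ = 4 * (M * h) := by rw [hMh]
      _ = h * (4 * M) := by ring
  have hhR2 : 16 * (h / R ^ 2) ≤ θhi' := by
    rw [hθhi', mul_div_assoc', div_le_div_iff₀ hR2 hMpos]
    have h1 : -t' < R ^ 2 := by linarith only [ht'gtR]
    calc 16 * h * M = 16 * (M * h) := by ring
      _ = 16 * -t' := by rw [hMh]
      _ ≤ 16 * R ^ 2 := by linarith only [h1]
  have hhR3 : 4 * (h / R ^ 2) ≤ θ₀₁ := by
    refine le_trans ?_ hMθ
    rw [mul_div_assoc', div_le_div_iff₀ hR2 hMpos]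
    have h1 : -t' < R ^ 2 := by linarith only [ht'gtR]
    calc 4 * h * M = 4 * (M * h) := by ring
      _ = 4 * -t' := by rw [hMh]
      _ ≤ 4 * R ^ 2 := by linarith only [h1]
  have hlev0 : 0 < (2 : ℝ)⁻¹ ^ s * (δ₀ * κ / 3) / 2 := by positivity
  have hlev1 : (2 : ℝ)⁻¹ ^ s * (δ₀ * κ / 3) / 2 ≤ k := by linarith only [hl1, hl0]
  have hsl' : ∀ᵐ x ∂(volume.restrict (ball (0 : EuclideanSpace ℝ (Fin 3)) R)),
      (2 : ℝ)⁻¹ ^ s * (δ₀ * κ / 3) / 2 ≤ Φ (-((M : ℝ) * h)) x := by rw [ht'eq]; exact hsl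
  have hchain := chain_lowerBound hS hSax hcont (h32' Φ U S k R hSt) (h33' Φ U S k R hSt)
    (h31' Φ U S k R hSt) hμ'le hM1 (le_of_eq hlamlo') hR hhpos hMh' hhR1 hhR2 hhR3 hlev0 hlev1 hsl'
  rw [ht'eq] at hchain
  -- ### conclusion on `Q(R/2) ⊆ ]t', 0[ × B(R/2)`
  have hsub : parabolicCylinder (R / 2) (0 : ℝ × EuclideanSpace ℝ (Fin 3)) ⊆
      Ioo t' 0 ×ˢ ball (0 : EuclideanSpace ℝ (Fin 3)) (R / 2) := by
    intro z hz
    rw [mem_parabolicCylinder] at hz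
    obtain ⟨⟨hz1, hz2⟩, hz3⟩ := hz
    simp only [Prod.fst_zero, Prod.snd_zero, zero_sub] at hz1 hz2 hz3
    refine ⟨⟨?_, hz2⟩, mem_ball.2 hz3⟩
    have h1 : -R ^ 2 / 4 = -(R / 2) ^ 2 := by ring
    linarith only [hz1, ht'le, h1]
  filter_upwards [ae_restrict_of_ae_restrict_of_subset hsub hchain] with z hz
  calc ((2 : ℝ)⁻¹ ^ (s' + 1) / 3) ^ M * ((2 : ℝ)⁻¹ ^ (s + 1) * δ₀ / 3) * κ
      = ((2 : ℝ)⁻¹ ^ (s' + 1) / 3) ^ M * ((2 : ℝ)⁻¹ ^ s * (δ₀ * κ / 3) / 2) := by ring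
    _ ≤ Φ z.1 z.2 := hz

end Summit.NavierStokesRegularity.NavierStokesRegularity.Theorems.AxisymmetricKatoGlobal.EulerScaling

end
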